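/-
Copyright (c) 2026 the pub-hodgecm-mathlib formalisation cell (harness21).  Prover seat hodgecm-mathlib-K2E1-p15 (g3), Track B ∕ K2-LIT, h413 = `stmt-HodgeConjecture-24833`,
R90-TF section S8 «ContSpec-n½», #4′ road (`sock_S8_resH_spannedByCharLines` :464, H side), deal S8-R147 (c1): the TOP-LEVEL ASSEMBLY of the block-model family — at
`(K_max, ω = 1)` every block of the C7 index is modelled (self-dual: ★ p863337, `Sum.inl`; off-dual: ★ p862711, `Sum.inr`), so (O) holds there with its model letter `hOD` GONE.
-/
import Summits.HodgeConjecture.HodgeConjecture.Theorems.R90S8ResHBlockSelfDualModelM1RepsU2   -- ★ p863337 (this seat): `exists_selfDual_isometry_resHBlock_m1'` (+ ★ p862602 `exists_blockModelFamily`, `hOD_of_blockModelFamily`, (O) `…_of_hOD`)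
import Summits.HodgeConjecture.HodgeConjecture.Theorems.R90S8ResHBlockOffDualModelU2          -- ★ p862711 (this seat): `exists_offDual_isometry_resHBlock'`
import Summits.HodgeConjecture.HodgeConjecture.Theorems.K2E1FamilyIndexSplitSelfDualU2        -- ★ p861051 (K2E1-p12): `not_isNormTwist_mul_inv_reflectChar_of_rayTrivial_of_ne`
import HarnessLib

/-!
# S8 #4′ road — `R90S8ResHBlockModelFamilyTopU2`: at the top level `(K_max, ω = 1)` a block-model family `U` EXISTS (self-dual blocks left-modelled by ★ M1, off-dual blocks
# right-modelled by ★ D4′), and (O) `(⨆_b At_b) ⟂ (⨆_b Ln_b)` holds there with the model letter `hOD` discharged (deal S8-R147 (c1))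

Track B ∕ K2-LIT, crux h413 = `stmt-HodgeConjecture-24833`, route of record `HCCMUnconditional`; cell `hodgecm-mathlib`, R90-TF programme, section S8 «ContSpec-n½», socket #4′
`sock_S8_resH_spannedByCharLines` (B :464, H side), LAYER 2 PRINT ★ p862113 letter `hO`.  THEOREMS ONLY (no `def`, no `instance`, no `notation`, no named-fact hypothesis, no
`sorry`; default heartbeats); lane `--supports stmt-HodgeConjecture-24833 --as helper` (count-neutral).  CLOSES NO SOCKET.  It ASSEMBLES ★ `exists_blockModelFamily` (p862602 §6) at
the top level `K′ = K_max = adelicVal⁻¹(K_∞·GL₂(𝒪̂))` (= H7's `Kad K₀`, ★ `resHBlock_kad_top_one_eq_maximalLevel`), `ω = 1`: for every block `b` of the C7 index `S_1(K_max)`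
(ray-trivial `χ_b` with `V(χ_b, K_max, 1) ≠ ⊥`), EITHER `χ_b` is self-dual and ★ p863337 `exists_selfDual_isometry_resHBlock_m1'` gives `model b = Sum.inl Uiso_b` (atoms = residues at
the real poles, line = `L²((0,∞); ℂφ₀)`), OR `χ_b` is off-dual (★ `not_isNormTwist_mul_inv_reflectChar_of_rayTrivial_of_ne`; unitarity ★ `isUnitary_coe_index`) and ★ p862711
`exists_offDual_isometry_resHBlock'` gives `model b = Sum.inr U_od,b` (no atoms).  Hence a family `U b : L² →ₗ A_b × Λ_b` with `hUfac`, `hUinj`, and `hOD` (★ `hOD_of_blockModelFamily`) —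
and (O) ★ `isOrtho_iSup_resHAtom_iSup_resHLine_of_hOD` fires: **at the top level the (O) clause of #4′ carries NO model letter**.
VISIBLE BINDERS (all structural ∕ per-block data, none analytic): RUNG-1 Haar ∕ fundamental-domain data `νG μK νI 𝓕I ν 𝓕 (ν𝓕 = 1)`, covering weight `β` + `μZ`, `c² = 1`, and for every
SELF-DUAL block `b` a normalised section `φ₀_b ∈ V(χ_b, K_max, 1)` (`hφV hφc hφM hφinf hφ1 hφ1r`) with its `L²(K_max)` representative `v_b`, and `σ₀ > 1`.  The types `A_b, Λ_b` and their
Hilbert structures are OUTPUTS (existentially bound with their instances, RUNG-1 FINAL's idiom).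
* **`exists_blockModelFamily_top`** — `∃ A Λ (instances) (U : ∀ b, L² →ₗ[ℂ] A b × Λ b), hUfac ∧ hUinj ∧ hOD ∧ (⨆ b, resHAtom (U b)) ⟂ (⨆ b, resHLine (U b))` at `(K_max, 1)`.
HONEST LABEL: HC_CM is proved only modulo the 7 printed citations (2 remaining named inputs: hLiu418 = `stmt-HodgeConjecture-24832`, h413 = `stmt-HodgeConjecture-24833`) until
rung 0 closes; REL ≠ ★ ≠ BUILT; H-side model bricks close no socket — #4′ :464 stays `sorry` in B; this file covers the TOP level family only (the G9 LEVEL package is the blocker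
below `K_max` and for `χ∞ ≠ 1`); count-neutral.

## References
* [MoeglinWaldspurger1995] C. Mœglin, J.-L. Waldspurger, *Spectral Decomposition and Eisenstein Series* (1995), II.1.7, II.2.1, II.2.4, IV.1.10, VI.2.
* [ReedSimonI1980] M. Reed, B. Simon, *Methods of Modern Mathematical Physics I* (1980), Thm. II.3.
-/

set_option autoImplicit false
set_option linter.dupNamespace false  -- the mandated namespace `…HodgeConjecture.HodgeConjecture.R90.S8` (LEAD #1 L1) repeats the summit's segment

noncomputable section

open MeasureTheory MeasureTheory.Measure Set NumberField IsDedekindDomain Filter Topology Complex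
open scoped Real NNReal ENNReal ComplexConjugate InnerProductSpace BigOperators
open Literature.MeasureTheory.Group Literature.NumberTheory
open Literature.NumberTheory.Automorphic Literature.NumberTheory.Automorphic.UnitaryGroup AdelicGroupData
open Literature.NumberTheory.GaloisRepresentations
open Summit.HodgeConjecture.HodgeConjecture.Cruxes.H413.K2E1BorelEisensteinU
open Summit.HodgeConjecture.HodgeConjecture.Cruxes.H413.K2E1BLBorelSpacesU2Defs
open Summit.HodgeConjecture.HodgeConjecture.Cruxes.H413.K2E1BLBorelOperatorsU2Defs
open Summit.HodgeConjecture.HodgeConjecture.Cruxes.H413.K2E1CharacterEisensteinU2Defs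
open Summit.HodgeConjecture.HodgeConjecture.Cruxes.H413.K2E1ChiSectionSpaceU2Defs
open Summit.HodgeConjecture.HodgeConjecture.Cruxes.H413.K2E1FamilyIndexSplitSelfDualU2 (not_isNormTwist_mul_inv_reflectChar_of_rayTrivial_of_ne)

namespace Summit.HodgeConjecture.HodgeConjecture.R90.S8

variable (L : Type) [Field L] [NumberField L] [IsCMField L]
  [MeasurableSpace (quasiSplit (↥(maximalRealSubfield L)) L (IsCMField.complexConj L) 2).Adelic] [BorelSpace (quasiSplit (↥(maximalRealSubfield L)) L (IsCMField.complexConj L) 2).Adelic]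
  [MeasurableSpace (AdeleRing (𝓞 L) L)ˣ] [BorelSpace (AdeleRing (𝓞 L) L)ˣ]
  (μ : Measure (quasiSplit (↥(maximalRealSubfield L)) L (IsCMField.complexConj L) 2).automorphicQuotient) [(quasiSplit (↥(maximalRealSubfield L)) L (IsCMField.complexConj L) 2).IsAutomorphicMeasure μ]

/-- **THE TOP-LEVEL BLOCK-MODEL FAMILY AND (O) WITHOUT `hOD`.**  At `(K_max, ω = 1)`: given the RUNG-1 structural data and, for every SELF-DUAL block `b` of the C7 index, a normalised
section `φ₀_b` of `V(χ_b, K_max, 1)` with its `L²(K_max)` representative, there are Hilbert spaces `A_b, Λ_b` and a family `U b : L²(𝔛) →ₗ A_b × Λ_b` such that: (`hUfac`) `U b` factors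
through `P_{Sc_b}`; (`hUinj`) `U b` is injective on `Sc_b`; (`hOD`) every OFF-DUAL block has no pure atoms, `resHAtom (U b) = ⊥`; and **(O)** `(⨆_b resHAtom (U b)) ⟂ (⨆_b resHLine (U b))`.
Self-dual blocks: ★ p863337 (`Sum.inl`); off-dual blocks: ★ p862711 (`Sum.inr`); packaging ★ `exists_blockModelFamily` + `hOD_of_blockModelFamily`; (O) ★ `isOrtho_iSup_resHAtom_iSup_resHLine_of_hOD`.
[cite: MoeglinWaldspurger1995, II.1.7, II.2.1, IV.1.10, VI.2] [cite: ReedSimonI1980, Thm. II.3] -/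
theorem exists_blockModelFamily_top
    (νG : Measure (quasiSplit (↥(maximalRealSubfield L)) L (IsCMField.complexConj L) 2).Adelic) [νG.IsHaarMeasure] [νG.IsInvInvariant] [SFinite νG]
    (μK : Measure ↥((standardMaximalCompactGL 2 L).comap (adelicVal (↥(maximalRealSubfield L)) L (IsCMField.complexConj L) 2 ((StdForm.antidiagonal 2).over L)) : Subgroup (quasiSplit (↥(maximalRealSubfield L)) L (IsCMField.complexConj L) 2).Adelic)) [μK.IsHaarMeasure]
    (νI : Measure (AdeleRing (𝓞 L) L)ˣ) [νI.IsHaarMeasure]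
    {𝓕I : Set (AdeleRing (𝓞 L) L)ˣ} (h𝓕I : IsIdeleClassDomain L 𝓕I)
    (ν : Measure ↥(adelicUnipotent (↥(maximalRealSubfield L)) L (IsCMField.complexConj L) 2)) [ν.IsHaarMeasure] [ν.IsMulRightInvariant] [ν.IsInvInvariant]
    {𝓕 : Set ↥(adelicUnipotent (↥(maximalRealSubfield L)) L (IsCMField.complexConj L) 2)} (h𝓕N : IsFundamentalDomain ↥(rationalUnipotent (↥(maximalRealSubfield L)) L (IsCMField.complexConj L) 2) 𝓕 ν) (h𝓕1 : ν 𝓕 = 1)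
    (h𝓕c : IsCompact (closure 𝓕))
    {β : (quasiSplit (↥(maximalRealSubfield L)) L (IsCMField.complexConj L) 2).Adelic → ℝ≥0∞} (hβ : IsCoveringWeight ↥((arithmeticBorel (↥(maximalRealSubfield L)) L (IsCMField.complexConj L) 2).map (quasiSplit (↥(maximalRealSubfield L)) L (IsCMField.complexConj L) 2).arithmeticSubgroup.subtype) β)
    {μZ : Measure (borelQuotient (↥(maximalRealSubfield L)) L (IsCMField.complexConj L) 2)} [SFinite μZ]
    (hμZ : ∀ f : borelQuotient (↥(maximalRealSubfield L)) L (IsCMField.complexConj L) 2 → ℝ≥0∞, Measurable f → ∫⁻ z, f z ∂μZ = ∫⁻ g, β g * f (toBorelQuotient (↥(maximalRealSubfield L)) L (IsCMField.complexConj L) 2 g) ∂νG)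
    (hc : IsCMField.complexConj L * IsCMField.complexConj L = 1)
    (φ₀ : ∀ b : ↥{χ : HeckeCharacter L | (∀ r : ℝ≥0ˣ, χ (posRealIdele L r) = 1) ∧ chiSectionSpace χ ((standardMaximalCompactGL 2 L).comap (adelicVal (↥(maximalRealSubfield L)) L (IsCMField.complexConj L) 2 ((StdForm.antidiagonal 2).over L)) : Subgroup (quasiSplit (↥(maximalRealSubfield L)) L (IsCMField.complexConj L) 2).Adelic) ((1 : ↥((standardMaximalCompactGL 2 L).comap (adelicVal (↥(maximalRealSubfield L)) L (IsCMField.complexConj L) 2 ((StdForm.antidiagonal 2).over L)) : Subgroup (quasiSplit (↥(maximalRealSubfield L)) L (IsCMField.complexConj L) 2).Adelic) →* ℂ) : ↥((standardMaximalCompactGL 2 L).comap (adelicVal (↥(maximalRealSubfield L)) L (IsCMField.complexConj L) 2 ((StdForm.antidiagonal 2).over L)) : Subgroup (quasiSplit (↥(maximalRealSubfield L)) L (IsCMField.complexConj L) 2).Adelic) → ℂ) ≠ ⊥}, reflectChar (IsCMField.complexConj L) (b : HeckeCharacter L) = (b : HeckeCharacter L) → (quasiSplit (↥(maximalRealSubfield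 L)) L (IsCMField.complexConj L) 2).Adelic → ℂ)
    (hφV : ∀ (b : ↥{χ : HeckeCharacter L | (∀ r : ℝ≥0ˣ, χ (posRealIdele L r) = 1) ∧ chiSectionSpace χ ((standardMaximalCompactGL 2 L).comap (adelicVal (↥(maximalRealSubfield L)) L (IsCMField.complexConj L) 2 ((StdForm.antidiagonal 2).over L)) : Subgroup (quasiSplit (↥(maximalRealSubfield L)) L (IsCMField.complexConj L) 2).Adelic) ((1 : ↥((standardMaximalCompactGL 2 L).comap (adelicVal (↥(maximalRealSubfield L)) L (IsCMField.complexConj L) 2 ((StdForm.antidiagonal 2).over L)) : Subgroup (quasiSplit (↥(maximalRealSubfield L)) L (IsCMField.complexConj L) 2).Adelic) →* ℂ) : ↥((standardMaximalCompactGL 2 L).comap (adelicVal (↥(maximalRealSubfield L)) L (IsCMField.complexConj L) 2 ((StdForm.antidiagonal 2).over L)) : Subgroup (quasiSplit (↥(maximalRealSubfield L)) L (IsCMField.complexConj L) 2).Adelic) → ℂ) ≠ ⊥}) (h : reflectChar (IsCMField.complexConj L) (b : HeckeCharacter L) = (b : HeckeCharacter L)), φ₀ b h ∈ chiSectionSpace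 (b : HeckeCharacter L) ((standardMaximalCompactGL 2 L).comap (adelicVal (↥(maximalRealSubfield L)) L (IsCMField.complexConj L) 2 ((StdForm.antidiagonal 2).over L)) : Subgroup (quasiSplit (↥(maximalRealSubfield L)) L (IsCMField.complexConj L) 2).Adelic) (fun _ => 1))
    (hφc : ∀ (b : ↥{χ : HeckeCharacter L | (∀ r : ℝ≥0ˣ, χ (posRealIdele L r) = 1) ∧ chiSectionSpace χ ((standardMaximalCompactGL 2 L).comap (adelicVal (↥(maximalRealSubfield L)) L (IsCMField.complexConj L) 2 ((StdForm.antidiagonal 2).over L)) : Subgroup (quasiSplit (↥(maximalRealSubfield L)) L (IsCMField.complexConj L) 2).Adelic) ((1 : ↥((standardMaximalCompactGL 2 L).comap (adelicVal (↥(maximalRealSubfield L)) L (IsCMField.complexConj L) 2 ((StdForm.antidiagonal 2).over L)) : Subgroup (quasiSplit (↥(maximalRealSubfield L)) L (IsCMField.complexConj L) 2).Adelic) →* ℂ) : ↥((standardMaximalCompactGL 2 L).comap (adelicVal (↥(maximalRealSubfield L)) L (IsCMField.complexConj L) 2 ((StdForm.antidiagonal 2).over L)) : Subgroup (quasiSplit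 (↥(maximalRealSubfield L)) L (IsCMField.complexConj L) 2).Adelic) → ℂ) ≠ ⊥}) (h : reflectChar (IsCMField.complexConj L) (b : HeckeCharacter L) = (b : HeckeCharacter L)), Continuous (φ₀ b h))
    (Mφ : ∀ b : ↥{χ : HeckeCharacter L | (∀ r : ℝ≥0ˣ, χ (posRealIdele L r) = 1) ∧ chiSectionSpace χ ((standardMaximalCompactGL 2 L).comap (adelicVal (↥(maximalRealSubfield L)) L (IsCMField.complexConj L) 2 ((StdForm.antidiagonal 2).over L)) : Subgroup (quasiSplit (↥(maximalRealSubfield L)) L (IsCMField.complexConj L) 2).Adelic) ((1 : ↥((standardMaximalCompactGL 2 L).comap (adelicVal (↥(maximalRealSubfield L)) L (IsCMField.complexConj L) 2 ((StdForm.antidiagonal 2).over L)) : Subgroup (quasiSplit (↥(maximalRealSubfield L)) L (IsCMField.complexConj L) 2).Adelic) →* ℂ) : ↥((standardMaximalCompactGL 2 L).comap (adelicVal (↥(maximalRealSubfield L)) L (IsCMField.complexConj L) 2 ((StdForm.antidiagonal 2).over L)) : Subgroup (quasiSplit (↥(maximalRealSubfield L)) L (IsCMField.complexConj L) 2).Adelic)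 → ℂ) ≠ ⊥}, reflectChar (IsCMField.complexConj L) (b : HeckeCharacter L) = (b : HeckeCharacter L) → ℝ) (hφM : ∀ (b : ↥{χ : HeckeCharacter L | (∀ r : ℝ≥0ˣ, χ (posRealIdele L r) = 1) ∧ chiSectionSpace χ ((standardMaximalCompactGL 2 L).comap (adelicVal (↥(maximalRealSubfield L)) L (IsCMField.complexConj L) 2 ((StdForm.antidiagonal 2).over L)) : Subgroup (quasiSplit (↥(maximalRealSubfield L)) L (IsCMField.complexConj L) 2).Adelic) ((1 : ↥((standardMaximalCompactGL 2 L).comap (adelicVal (↥(maximalRealSubfield L)) L (IsCMField.complexConj L) 2 ((StdForm.antidiagonal 2).over L)) : Subgroup (quasiSplit (↥(maximalRealSubfield L)) L (IsCMField.complexConj L) 2).Adelic) →* ℂ) : ↥((standardMaximalCompactGL 2 L).comap (adelicVal (↥(maximalRealSubfield L)) L (IsCMField.complexConj L) 2 ((StdForm.antidiagonal 2).over L)) : Subgroup (quasiSplit (↥(maximalRealSubfield L)) L (IsCMField.complexConj L) 2).Adelic) → ℂ) ≠ ⊥}) (h : reflectChar (IsCMField.complexConj L) (b : HeckeCharacter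 L) = (b : HeckeCharacter L)) (x : (quasiSplit (↥(maximalRealSubfield L)) L (IsCMField.complexConj L) 2).Adelic), ‖φ₀ b h x‖ ≤ Mφ b h)
    (hφinf : ∀ (b : ↥{χ : HeckeCharacter L | (∀ r : ℝ≥0ˣ, χ (posRealIdele L r) = 1) ∧ chiSectionSpace χ ((standardMaximalCompactGL 2 L).comap (adelicVal (↥(maximalRealSubfield L)) L (IsCMField.complexConj L) 2 ((StdForm.antidiagonal 2).over L)) : Subgroup (quasiSplit (↥(maximalRealSubfield L)) L (IsCMField.complexConj L) 2).Adelic) ((1 : ↥((standardMaximalCompactGL 2 L).comap (adelicVal (↥(maximalRealSubfield L)) L (IsCMField.complexConj L) 2 ((StdForm.antidiagonal 2).over L)) : Subgroup (quasiSplit (↥(maximalRealSubfield L)) L (IsCMField.complexConj L) 2).Adelic) →* ℂ) : ↥((standardMaximalCompactGL 2 L).comap (adelicVal (↥(maximalRealSubfield L)) L (IsCMField.complexConj L) 2 ((StdForm.antidiagonal 2).over L)) : Subgroup (quasiSplit (↥(maximalRealSubfield L)) L (IsCMField.complexConj L) 2).Adelic) → ℂ) ≠ ⊥}) (h : reflectChar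 (IsCMField.complexConj L) (b : HeckeCharacter L) = (b : HeckeCharacter L)) (a : arch (↥(maximalRealSubfield L)) L (IsCMField.complexConj L) 2 ((StdForm.antidiagonal 2).over L)),
      φ₀ b h (archToAdelic (↥(maximalRealSubfield L)) L (IsCMField.complexConj L) 2 _ a) = φ₀ b h 1)
    (hφ1 : ∀ (b : ↥{χ : HeckeCharacter L | (∀ r : ℝ≥0ˣ, χ (posRealIdele L r) = 1) ∧ chiSectionSpace χ ((standardMaximalCompactGL 2 L).comap (adelicVal (↥(maximalRealSubfield L)) L (IsCMField.complexConj L) 2 ((StdForm.antidiagonal 2).over L)) : Subgroup (quasiSplit (↥(maximalRealSubfield L)) L (IsCMField.complexConj L) 2).Adelic) ((1 : ↥((standardMaximalCompactGL 2 L).comap (adelicVal (↥(maximalRealSubfield L)) L (IsCMField.complexConj L) 2 ((StdForm.antidiagonal 2).over L)) : Subgroup (quasiSplit (↥(maximalRealSubfield L)) L (IsCMField.complexConj L) 2).Adelic) →* ℂ) : ↥((standardMaximalCompactGL 2 L).comap (adelicVal (↥(maximalRealSubfield L)) L (IsCMField.complexConj L) 2 ((StdForm.antidiagonal 2).over L))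 : Subgroup (quasiSplit (↥(maximalRealSubfield L)) L (IsCMField.complexConj L) 2).Adelic) → ℂ) ≠ ⊥}) (h : reflectChar (IsCMField.complexConj L) (b : HeckeCharacter L) = (b : HeckeCharacter L)), φ₀ b h 1 ≠ 0) (hφ1r : ∀ (b : ↥{χ : HeckeCharacter L | (∀ r : ℝ≥0ˣ, χ (posRealIdele L r) = 1) ∧ chiSectionSpace χ ((standardMaximalCompactGL 2 L).comap (adelicVal (↥(maximalRealSubfield L)) L (IsCMField.complexConj L) 2 ((StdForm.antidiagonal 2).over L)) : Subgroup (quasiSplit (↥(maximalRealSubfield L)) L (IsCMField.complexConj L) 2).Adelic) ((1 : ↥((standardMaximalCompactGL 2 L).comap (adelicVal (↥(maximalRealSubfield L)) L (IsCMField.complexConj L) 2 ((StdForm.antidiagonal 2).over L)) : Subgroup (quasiSplit (↥(maximalRealSubfield L)) L (IsCMField.complexConj L) 2).Adelic) →* ℂ) : ↥((standardMaximalCompactGL 2 L).comap (adelicVal (↥(maximalRealSubfield L)) L (IsCMField.complexConj L) 2 ((StdForm.antidiagonal 2).over L)) : Subgroup (quasiSplit (↥(maximalRealSubfield L)) L (IsCMField.complexConj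 L) 2).Adelic) → ℂ) ≠ ⊥}) (h : reflectChar (IsCMField.complexConj L) (b : HeckeCharacter L) = (b : HeckeCharacter L)), conj (φ₀ b h 1) = φ₀ b h 1)
    (v : ∀ b : ↥{χ : HeckeCharacter L | (∀ r : ℝ≥0ˣ, χ (posRealIdele L r) = 1) ∧ chiSectionSpace χ ((standardMaximalCompactGL 2 L).comap (adelicVal (↥(maximalRealSubfield L)) L (IsCMField.complexConj L) 2 ((StdForm.antidiagonal 2).over L)) : Subgroup (quasiSplit (↥(maximalRealSubfield L)) L (IsCMField.complexConj L) 2).Adelic) ((1 : ↥((standardMaximalCompactGL 2 L).comap (adelicVal (↥(maximalRealSubfield L)) L (IsCMField.complexConj L) 2 ((StdForm.antidiagonal 2).over L)) : Subgroup (quasiSplit (↥(maximalRealSubfield L)) L (IsCMField.complexConj L) 2).Adelic) →* ℂ) : ↥((standardMaximalCompactGL 2 L).comap (adelicVal (↥(maximalRealSubfield L)) L (IsCMField.complexConj L) 2 ((StdForm.antidiagonal 2).over L)) : Subgroup (quasiSplit (↥(maximalRealSubfield L)) L (IsCMField.complexConj L) 2).Adelic) → ℂ) ≠ ⊥}, reflectChar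 (IsCMField.complexConj L) (b : HeckeCharacter L) = (b : HeckeCharacter L) → Lp ℂ 2 μK)
    (hv : ∀ (b : ↥{χ : HeckeCharacter L | (∀ r : ℝ≥0ˣ, χ (posRealIdele L r) = 1) ∧ chiSectionSpace χ ((standardMaximalCompactGL 2 L).comap (adelicVal (↥(maximalRealSubfield L)) L (IsCMField.complexConj L) 2 ((StdForm.antidiagonal 2).over L)) : Subgroup (quasiSplit (↥(maximalRealSubfield L)) L (IsCMField.complexConj L) 2).Adelic) ((1 : ↥((standardMaximalCompactGL 2 L).comap (adelicVal (↥(maximalRealSubfield L)) L (IsCMField.complexConj L) 2 ((StdForm.antidiagonal 2).over L)) : Subgroup (quasiSplit (↥(maximalRealSubfield L)) L (IsCMField.complexConj L) 2).Adelic) →* ℂ) : ↥((standardMaximalCompactGL 2 L).comap (adelicVal (↥(maximalRealSubfield L)) L (IsCMField.complexConj L) 2 ((StdForm.antidiagonal 2).over L)) : Subgroup (quasiSplit (↥(maximalRealSubfield L)) L (IsCMField.complexConj L) 2).Adelic) → ℂ) ≠ ⊥}) (h : reflectChar (IsCMField.complexConj L) (b : HeckeCharacter L) = (b : HeckeCharacter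 L)), ((v b h : Lp ℂ 2 μK) : ↥((standardMaximalCompactGL 2 L).comap (adelicVal (↥(maximalRealSubfield L)) L (IsCMField.complexConj L) 2 ((StdForm.antidiagonal 2).over L)) : Subgroup (quasiSplit (↥(maximalRealSubfield L)) L (IsCMField.complexConj L) 2).Adelic) → ℂ) =ᵐ[μK] fun k => φ₀ b h (k : (quasiSplit (↥(maximalRealSubfield L)) L (IsCMField.complexConj L) 2).Adelic))
    {σ₀ : ℝ} (hσ₀ : 1 < σ₀) :
    ∃ (A Λ : ↥{χ : HeckeCharacter L | (∀ r : ℝ≥0ˣ, χ (posRealIdele L r) = 1) ∧ chiSectionSpace χ ((standardMaximalCompactGL 2 L).comap (adelicVal (↥(maximalRealSubfield L)) L (IsCMField.complexConj L) 2 ((StdForm.antidiagonal 2).over L)) : Subgroup (quasiSplit (↥(maximalRealSubfield L)) L (IsCMField.complexConj L) 2).Adelic) ((1 : ↥((standardMaximalCompactGL 2 L).comap (adelicVal (↥(maximalRealSubfield L)) L (IsCMField.complexConj L) 2 ((StdForm.antidiagonal 2).over L)) : Subgroup (quasiSplit (↥(maximalRealSubfield L)) L (IsCMField.complexConj L) 2).Adelic)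 →* ℂ) : ↥((standardMaximalCompactGL 2 L).comap (adelicVal (↥(maximalRealSubfield L)) L (IsCMField.complexConj L) 2 ((StdForm.antidiagonal 2).over L)) : Subgroup (quasiSplit (↥(maximalRealSubfield L)) L (IsCMField.complexConj L) 2).Adelic) → ℂ) ≠ ⊥} → Type) (_ : ∀ b, NormedAddCommGroup (A b)) (_ : ∀ b, InnerProductSpace ℂ (A b)) (_ : ∀ b, NormedAddCommGroup (Λ b)) (_ : ∀ b, InnerProductSpace ℂ (Λ b))
      (U : ∀ b : ↥{χ : HeckeCharacter L | (∀ r : ℝ≥0ˣ, χ (posRealIdele L r) = 1) ∧ chiSectionSpace χ ((standardMaximalCompactGL 2 L).comap (adelicVal (↥(maximalRealSubfield L)) L (IsCMField.complexConj L) 2 ((StdForm.antidiagonal 2).over L)) : Subgroup (quasiSplit (↥(maximalRealSubfield L)) L (IsCMField.complexConj L) 2).Adelic) ((1 : ↥((standardMaximalCompactGL 2 L).comap (adelicVal (↥(maximalRealSubfield L)) L (IsCMField.complexConj L) 2 ((StdForm.antidiagonal 2).over L)) : Subgroup (quasiSplit (↥(maximalRealSubfield L)) L (IsCMField.complexConj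 L) 2).Adelic) →* ℂ) : ↥((standardMaximalCompactGL 2 L).comap (adelicVal (↥(maximalRealSubfield L)) L (IsCMField.complexConj L) 2 ((StdForm.antidiagonal 2).over L)) : Subgroup (quasiSplit (↥(maximalRealSubfield L)) L (IsCMField.complexConj L) 2).Adelic) → ℂ) ≠ ⊥}, (quasiSplit (↥(maximalRealSubfield L)) L (IsCMField.complexConj L) 2).L2 μ →ₗ[ℂ] A b × Λ b),
      (∀ (b : ↥{χ : HeckeCharacter L | (∀ r : ℝ≥0ˣ, χ (posRealIdele L r) = 1) ∧ chiSectionSpace χ ((standardMaximalCompactGL 2 L).comap (adelicVal (↥(maximalRealSubfield L)) L (IsCMField.complexConj L) 2 ((StdForm.antidiagonal 2).over L)) : Subgroup (quasiSplit (↥(maximalRealSubfield L)) L (IsCMField.complexConj L) 2).Adelic) ((1 : ↥((standardMaximalCompactGL 2 L).comap (adelicVal (↥(maximalRealSubfield L)) L (IsCMField.complexConj L) 2 ((StdForm.antidiagonal 2).over L)) : Subgroup (quasiSplit (↥(maximalRealSubfield L)) L (IsCMField.complexConj L) 2).Adelic) →* ℂ) : ↥((standardMaximalCompactGL 2 L).comap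 (adelicVal (↥(maximalRealSubfield L)) L (IsCMField.complexConj L) 2 ((StdForm.antidiagonal 2).over L)) : Subgroup (quasiSplit (↥(maximalRealSubfield L)) L (IsCMField.complexConj L) 2).Adelic) → ℂ) ≠ ⊥}) (y : (quasiSplit (↥(maximalRealSubfield L)) L (IsCMField.complexConj L) 2).L2 μ),
        ∃ y' ∈ resHBlock L μ ((standardMaximalCompactGL 2 L).comap (adelicVal (↥(maximalRealSubfield L)) L (IsCMField.complexConj L) 2 ((StdForm.antidiagonal 2).over L)) : Subgroup (quasiSplit (↥(maximalRealSubfield L)) L (IsCMField.complexConj L) 2).Adelic) (1 : ↥((standardMaximalCompactGL 2 L).comap (adelicVal (↥(maximalRealSubfield L)) L (IsCMField.complexConj L) 2 ((StdForm.antidiagonal 2).over L)) : Subgroup (quasiSplit (↥(maximalRealSubfield L)) L (IsCMField.complexConj L) 2).Adelic) →* ℂ) (b : HeckeCharacter L), y - y' ∈ (resHBlock L μ ((standardMaximalCompactGL 2 L).comap (adelicVal (↥(maximalRealSubfield L)) L (IsCMField.complexConj L) 2 ((StdForm.antidiagonal 2).over L)) : Subgroup (quasiSplit (↥(maximalRealSubfield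 L)) L (IsCMField.complexConj L) 2).Adelic) (1 : ↥((standardMaximalCompactGL 2 L).comap (adelicVal (↥(maximalRealSubfield L)) L (IsCMField.complexConj L) 2 ((StdForm.antidiagonal 2).over L)) : Subgroup (quasiSplit (↥(maximalRealSubfield L)) L (IsCMField.complexConj L) 2).Adelic) →* ℂ) (b : HeckeCharacter L))ᗮ ∧ U b y = U b y') ∧
      (∀ (b : ↥{χ : HeckeCharacter L | (∀ r : ℝ≥0ˣ, χ (posRealIdele L r) = 1) ∧ chiSectionSpace χ ((standardMaximalCompactGL 2 L).comap (adelicVal (↥(maximalRealSubfield L)) L (IsCMField.complexConj L) 2 ((StdForm.antidiagonal 2).over L)) : Subgroup (quasiSplit (↥(maximalRealSubfield L)) L (IsCMField.complexConj L) 2).Adelic) ((1 : ↥((standardMaximalCompactGL 2 L).comap (adelicVal (↥(maximalRealSubfield L)) L (IsCMField.complexConj L) 2 ((StdForm.antidiagonal 2).over L)) : Subgroup (quasiSplit (↥(maximalRealSubfield L)) L (IsCMField.complexConj L) 2).Adelic) →* ℂ) : ↥((standardMaximalCompactGL 2 L).comap (adelicVal (↥(maximalRealSubfield L)) L (IsCMField.complexConj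 L) 2 ((StdForm.antidiagonal 2).over L)) : Subgroup (quasiSplit (↥(maximalRealSubfield L)) L (IsCMField.complexConj L) 2).Adelic) → ℂ) ≠ ⊥}), ∀ y ∈ resHBlock L μ ((standardMaximalCompactGL 2 L).comap (adelicVal (↥(maximalRealSubfield L)) L (IsCMField.complexConj L) 2 ((StdForm.antidiagonal 2).over L)) : Subgroup (quasiSplit (↥(maximalRealSubfield L)) L (IsCMField.complexConj L) 2).Adelic) (1 : ↥((standardMaximalCompactGL 2 L).comap (adelicVal (↥(maximalRealSubfield L)) L (IsCMField.complexConj L) 2 ((StdForm.antidiagonal 2).over L)) : Subgroup (quasiSplit (↥(maximalRealSubfield L)) L (IsCMField.complexConj L) 2).Adelic) →* ℂ) (b : HeckeCharacter L), U b y = 0 → y = 0) ∧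
      (∀ b : ↥{χ : HeckeCharacter L | (∀ r : ℝ≥0ˣ, χ (posRealIdele L r) = 1) ∧ chiSectionSpace χ ((standardMaximalCompactGL 2 L).comap (adelicVal (↥(maximalRealSubfield L)) L (IsCMField.complexConj L) 2 ((StdForm.antidiagonal 2).over L)) : Subgroup (quasiSplit (↥(maximalRealSubfield L)) L (IsCMField.complexConj L) 2).Adelic) ((1 : ↥((standardMaximalCompactGL 2 L).comap (adelicVal (↥(maximalRealSubfield L)) L (IsCMField.complexConj L) 2 ((StdForm.antidiagonal 2).over L)) : Subgroup (quasiSplit (↥(maximalRealSubfield L)) L (IsCMField.complexConj L) 2).Adelic) →* ℂ) : ↥((standardMaximalCompactGL 2 L).comap (adelicVal (↥(maximalRealSubfield L)) L (IsCMField.complexConj L) 2 ((StdForm.antidiagonal 2).over L)) : Subgroup (quasiSplit (↥(maximalRealSubfield L)) L (IsCMField.complexConj L) 2).Adelic) → ℂ) ≠ ⊥}, reflectChar (IsCMField.complexConj L) (b : HeckeCharacter L) ≠ (b : HeckeCharacter L) → resHAtom L μ (U b) ((standardMaximalCompactGL 2 L).comap (adelicVal (↥(maximalRealSubfield L)) L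 (IsCMField.complexConj L) 2 ((StdForm.antidiagonal 2).over L)) : Subgroup (quasiSplit (↥(maximalRealSubfield L)) L (IsCMField.complexConj L) 2).Adelic) (1 : ↥((standardMaximalCompactGL 2 L).comap (adelicVal (↥(maximalRealSubfield L)) L (IsCMField.complexConj L) 2 ((StdForm.antidiagonal 2).over L)) : Subgroup (quasiSplit (↥(maximalRealSubfield L)) L (IsCMField.complexConj L) 2).Adelic) →* ℂ) (b : HeckeCharacter L) = ⊥) ∧
      (⨆ b : ↥{χ : HeckeCharacter L | (∀ r : ℝ≥0ˣ, χ (posRealIdele L r) = 1) ∧ chiSectionSpace χ ((standardMaximalCompactGL 2 L).comap (adelicVal (↥(maximalRealSubfield L)) L (IsCMField.complexConj L) 2 ((StdForm.antidiagonal 2).over L)) : Subgroup (quasiSplit (↥(maximalRealSubfield L)) L (IsCMField.complexConj L) 2).Adelic) ((1 : ↥((standardMaximalCompactGL 2 L).comap (adelicVal (↥(maximalRealSubfield L)) L (IsCMField.complexConj L) 2 ((StdForm.antidiagonal 2).over L)) : Subgroup (quasiSplit (↥(maximalRealSubfield L)) L (IsCMField.complexConj L) 2).Adelic) →* ℂ)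 : ↥((standardMaximalCompactGL 2 L).comap (adelicVal (↥(maximalRealSubfield L)) L (IsCMField.complexConj L) 2 ((StdForm.antidiagonal 2).over L)) : Subgroup (quasiSplit (↥(maximalRealSubfield L)) L (IsCMField.complexConj L) 2).Adelic) → ℂ) ≠ ⊥}, resHAtom L μ (U b) ((standardMaximalCompactGL 2 L).comap (adelicVal (↥(maximalRealSubfield L)) L (IsCMField.complexConj L) 2 ((StdForm.antidiagonal 2).over L)) : Subgroup (quasiSplit (↥(maximalRealSubfield L)) L (IsCMField.complexConj L) 2).Adelic) (1 : ↥((standardMaximalCompactGL 2 L).comap (adelicVal (↥(maximalRealSubfield L)) L (IsCMField.complexConj L) 2 ((StdForm.antidiagonal 2).over L)) : Subgroup (quasiSplit (↥(maximalRealSubfield L)) L (IsCMField.complexConj L) 2).Adelic) →* ℂ) (b : HeckeCharacter L)) ⟂ (⨆ b : ↥{χ : HeckeCharacter L | (∀ r : ℝ≥0ˣ, χ (posRealIdele L r) = 1) ∧ chiSectionSpace χ ((standardMaximalCompactGL 2 L).comap (adelicVal (↥(maximalRealSubfield L)) L (IsCMField.complexConj L) 2 ((StdForm.antidiagonal 2).over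 L)) : Subgroup (quasiSplit (↥(maximalRealSubfield L)) L (IsCMField.complexConj L) 2).Adelic) ((1 : ↥((standardMaximalCompactGL 2 L).comap (adelicVal (↥(maximalRealSubfield L)) L (IsCMField.complexConj L) 2 ((StdForm.antidiagonal 2).over L)) : Subgroup (quasiSplit (↥(maximalRealSubfield L)) L (IsCMField.complexConj L) 2).Adelic) →* ℂ) : ↥((standardMaximalCompactGL 2 L).comap (adelicVal (↥(maximalRealSubfield L)) L (IsCMField.complexConj L) 2 ((StdForm.antidiagonal 2).over L)) : Subgroup (quasiSplit (↥(maximalRealSubfield L)) L (IsCMField.complexConj L) 2).Adelic) → ℂ) ≠ ⊥}, resHLine L μ (U b) ((standardMaximalCompactGL 2 L).comap (adelicVal (↥(maximalRealSubfield L)) L (IsCMField.complexConj L) 2 ((StdForm.antidiagonal 2).over L)) : Subgroup (quasiSplit (↥(maximalRealSubfield L)) L (IsCMField.complexConj L) 2).Adelic) (1 : ↥((standardMaximalCompactGL 2 L).comap (adelicVal (↥(maximalRealSubfield L)) L (IsCMField.complexConj L) 2 ((StdForm.antidiagonal 2).over L)) : Subgroup (quasiSplit (↥(maximalRealSubfield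 L)) L (IsCMField.complexConj L) 2).Adelic) →* ℂ) (b : HeckeCharacter L)) := by
  classical
  have h𝓕₀ : ν 𝓕 ≠ 0 := by rw [h𝓕1]; exact one_ne_zero
  -- per-block model data (types, Hilbert structures, model), by cases self-dual ∕ off-dual — no type-level case split survives: the types are existential witnesses
  have hblk : ∀ b : ↥{χ : HeckeCharacter L | (∀ r : ℝ≥0ˣ, χ (posRealIdele L r) = 1) ∧ chiSectionSpace χ ((standardMaximalCompactGL 2 L).comap (adelicVal (↥(maximalRealSubfield L)) L (IsCMField.complexConj L) 2 ((StdForm.antidiagonal 2).over L)) : Subgroup (quasiSplit (↥(maximalRealSubfield L)) L (IsCMField.complexConj L) 2).Adelic) ((1 : ↥((standardMaximalCompactGL 2 L).comap (adelicVal (↥(maximalRealSubfield L)) L (IsCMField.complexConj L) 2 ((StdForm.antidiagonal 2).over L)) : Subgroup (quasiSplit (↥(maximalRealSubfield L)) L (IsCMField.complexConj L) 2).Adelic) →* ℂ) : ↥((standardMaximalCompactGL 2 L).comap (adelicVal (↥(maximalRealSubfield L)) L (IsCMField.complexConj L) 2 ((StdForm.antidiagonal 2).over L)) : Subgroup (quasiSplit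 (↥(maximalRealSubfield L)) L (IsCMField.complexConj L) 2).Adelic) → ℂ) ≠ ⊥}, ∃ (A Λ : Type) (_ : NormedAddCommGroup A) (_ : InnerProductSpace ℂ A) (_ : NormedAddCommGroup Λ) (_ : InnerProductSpace ℂ Λ)
      (m : (↥(resHBlock L μ ((standardMaximalCompactGL 2 L).comap (adelicVal (↥(maximalRealSubfield L)) L (IsCMField.complexConj L) 2 ((StdForm.antidiagonal 2).over L)) : Subgroup (quasiSplit (↥(maximalRealSubfield L)) L (IsCMField.complexConj L) 2).Adelic) (1 : ↥((standardMaximalCompactGL 2 L).comap (adelicVal (↥(maximalRealSubfield L)) L (IsCMField.complexConj L) 2 ((StdForm.antidiagonal 2).over L)) : Subgroup (quasiSplit (↥(maximalRealSubfield L)) L (IsCMField.complexConj L) 2).Adelic) →* ℂ) (b : HeckeCharacter L)) →ₗᵢ[ℂ] WithLp 2 (A × Λ)) ⊕ (↥(resHBlock L μ ((standardMaximalCompactGL 2 L).comap (adelicVal (↥(maximalRealSubfield L)) L (IsCMField.complexConj L) 2 ((StdForm.antidiagonal 2).over L)) : Subgroup (quasiSplit (↥(maximalRealSubfield L)) L (IsCMField.complexConj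 L) 2).Adelic) (1 : ↥((standardMaximalCompactGL 2 L).comap (adelicVal (↥(maximalRealSubfield L)) L (IsCMField.complexConj L) 2 ((StdForm.antidiagonal 2).over L)) : Subgroup (quasiSplit (↥(maximalRealSubfield L)) L (IsCMField.complexConj L) 2).Adelic) →* ℂ) (b : HeckeCharacter L)) →ₗᵢ[ℂ] Λ)),
      (reflectChar (IsCMField.complexConj L) (b : HeckeCharacter L) ≠ (b : HeckeCharacter L) → ∃ Uiso, m = Sum.inr Uiso) := by
    intro b
    have hχu := isUnitary_coe_index L ((standardMaximalCompactGL 2 L).comap (adelicVal (↥(maximalRealSubfield L)) L (IsCMField.complexConj L) 2 ((StdForm.antidiagonal 2).over L)) : Subgroup (quasiSplit (↥(maximalRealSubfield L)) L (IsCMField.complexConj L) 2).Adelic) (1 : ↥((standardMaximalCompactGL 2 L).comap (adelicVal (↥(maximalRealSubfield L)) L (IsCMField.complexConj L) 2 ((StdForm.antidiagonal 2).over L)) : Subgroup (quasiSplit (↥(maximalRealSubfield L)) L (IsCMField.complexConj L) 2).Adelic) →* ℂ) b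
    by_cases hsd : reflectChar (IsCMField.complexConj L) (b : HeckeCharacter L) = (b : HeckeCharacter L)
    · -- self-dual: ★ M1 (p863337), left model
      have H := exists_selfDual_isometry_resHBlock_m1' L μ νG μK νI h𝓕I ν h𝓕N h𝓕1 h𝓕c hβ hμZ hχu b.2.1 hsd (hφV b hsd) (hφc b hsd) (hφM b hsd) (hφinf b hsd) (hφ1 b hsd) (hφ1r b hsd)
        (v b hsd) (hv b hsd) hσ₀
      obtain ⟨s, P, C, S, ρ, r', w, Uiso, -⟩ := H
      exact ⟨PiLp 2 (fun _ : ↥S => ↥(Submodule.span ℂ (Set.range fun _ : Unit => v b hsd))),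
        Lp ↥(Submodule.span ℂ (Set.range fun _ : Unit => v b hsd)) 2 ((volume : Measure ℝ).restrict (Ioi 0)),
        inferInstance, inferInstance, inferInstance, inferInstance, Sum.inl Uiso, fun h => absurd hsd h⟩
    · -- off-dual: ★ D4′ (p862711), right model
      have H := exists_offDual_isometry_resHBlock' L μ ((standardMaximalCompactGL 2 L).comap (adelicVal (↥(maximalRealSubfield L)) L (IsCMField.complexConj L) 2 ((StdForm.antidiagonal 2).over L)) : Subgroup (quasiSplit (↥(maximalRealSubfield L)) L (IsCMField.complexConj L) 2).Adelic) (1 : ↥((standardMaximalCompactGL 2 L).comap (adelicVal (↥(maximalRealSubfield L)) L (IsCMField.complexConj L) 2 ((StdForm.antidiagonal 2).over L)) : Subgroup (quasiSplit (↥(maximalRealSubfield L)) L (IsCMField.complexConj L) 2).Adelic) →* ℂ) νG μK νI h𝓕I ν h𝓕N h𝓕c h𝓕₀ hχu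
        (not_isNormTwist_mul_inv_reflectChar_of_rayTrivial_of_ne b.2.1 hsd)
      obtain ⟨C, -, Uod, -⟩ := H
      exact ⟨EuclideanSpace ℂ (Fin 0), Lp ℂ 2 ((volume : Measure ℝ).prod μK),
        inferInstance, inferInstance, inferInstance, inferInstance, Sum.inr Uod, fun _ => ⟨Uod, rfl⟩⟩
  choose A Λ iA iA' iΛ iΛ' model hright using hblk
  -- the family (★ p862602 §6) and `hOD` from it
  obtain ⟨U, hUfac, hUinj, -, -, hUbot⟩ := exists_blockModelFamily L μ ((standardMaximalCompactGL 2 L).comap (adelicVal (↥(maximalRealSubfield L)) L (IsCMField.complexConj L) 2 ((StdForm.antidiagonal 2).over L)) : Subgroup (quasiSplit (↥(maximalRealSubfield L)) L (IsCMField.complexConj L) 2).Adelic) (1 : ↥((standardMaximalCompactGL 2 L).comap (adelicVal (↥(maximalRealSubfield L)) L (IsCMField.complexConj L) 2 ((StdForm.antidiagonal 2).over L)) : Subgroup (quasiSplit (↥(maximalRealSubfield L)) L (IsCMField.complexConj L) 2).Adelic) →* ℂ) model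
  have hOD := hOD_of_blockModelFamily L μ ((standardMaximalCompactGL 2 L).comap (adelicVal (↥(maximalRealSubfield L)) L (IsCMField.complexConj L) 2 ((StdForm.antidiagonal 2).over L)) : Subgroup (quasiSplit (↥(maximalRealSubfield L)) L (IsCMField.complexConj L) 2).Adelic) (1 : ↥((standardMaximalCompactGL 2 L).comap (adelicVal (↥(maximalRealSubfield L)) L (IsCMField.complexConj L) 2 ((StdForm.antidiagonal 2).over L)) : Subgroup (quasiSplit (↥(maximalRealSubfield L)) L (IsCMField.complexConj L) 2).Adelic) →* ℂ) hUbot hright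
  exact ⟨A, Λ, iA, iA', iΛ, iΛ', U, hUfac, hUinj, hOD,
    isOrtho_iSup_resHAtom_iSup_resHLine_of_hOD L μ νG μK νI h𝓕I ν h𝓕N h𝓕c h𝓕₀ hc ((standardMaximalCompactGL 2 L).comap (adelicVal (↥(maximalRealSubfield L)) L (IsCMField.complexConj L) 2 ((StdForm.antidiagonal 2).over L)) : Subgroup (quasiSplit (↥(maximalRealSubfield L)) L (IsCMField.complexConj L) 2).Adelic) (1 : ↥((standardMaximalCompactGL 2 L).comap (adelicVal (↥(maximalRealSubfield L)) L (IsCMField.complexConj L) 2 ((StdForm.antidiagonal 2).over L)) : Subgroup (quasiSplit (↥(maximalRealSubfield L)) L (IsCMField.complexConj L) 2).Adelic) →* ℂ) U hOD⟩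

end Summit.HodgeConjecture.HodgeConjecture.R90.S8

end
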